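import Literature.NumberTheory.LFunctions.Zhang2022.RepairRplusTightness
import Literature.NumberTheory.LFunctions.Zhang2022.KnifeEdgeOffDiagForm

/-!
# Zhang (2022) §18-margin repair rung — X-world bookkeeping «LARGE-SIEVE-TYPE off-diagonal input past `P`»:
# a diagonal-only range `Θ > 1` CLOSES, is not invisible, and does not exist in any PSD world

Trunk T-ANT (NumberTheory/LFunctions). Y. Zhang, *Discrete mean estimates and the Landau–Siegel
zero*, arXiv:2211.02515v1 (2022) [Zhang2022LandauSiegel] — **an unrefereed manuscript under
adjudication. WHAT THIS IS NOT: nothing here asserts or denies its Theorems 1–2 or any analytic lemma;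
no claim about Landau–Siegel zeros, about Parity, or about a repaired `Margin232` is made. Every statement
below is about the two-piece main-term FUNCTIONAL `KnifeEdge.twoPieceMainTerm θ X` of p442741 for an
abstract off-diagonal slot `X` — continued calculus + a displayed `Prop` on `X` — not about zeros of
`L`-functions.** Cell `landau-siegel` (rung F-S3), sub-cell E (barrier extension), seat p4; planner's word
18:30:46Z: «propose it yourself as `RepairDiagonalOnly.lean`; kind TIGHTNESS / X-world bookkeeping (not an
`Rplusplus` row); `diagonalOnlyUpTo_le_one_of_null` is the informative one». Requested by ls-Blen-plan
(18:02:59Z) as the KERNEL FORM of the S2 print-ceiling sentence of B-len/CEILING-len.md v1 (sha16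
3a7108a1cd5499c0): «every PRINTED asymptotic evaluation of a twisted/mollified second moment with the
diagonal (+ dual diagonal) as the only main term stops at `θ_print < 1` … it reaches the wall from below and
never crosses it».

## The predicate (kind (c), bare `Prop`, asserted for no `X`)

`DiagonalOnlyUpTo Θ X` := on every smooth two-piece design `s·u ⊕ v` of top `θ ∈ [1, Θ]` (`u` an
`InClassPiece`, `v` an `OverhangPiece θ`) BOTH slots of `X` read by `twoPieceMainTerm` vanish:
`X(u,v) = 0` (cross) and `X(v,v) = 0` (overhang) — «main term = diagonal (continued calculus), off-diagonal =
error term», the SHAPE of every printed asymptotic-large-sieve / BPRZ-type theorem (CIS ALS Thm 2.4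
`AsymptoticLargeSieve.theorem24`-type ranges `X ≤ Q^{1−ε}`; BPRZ20 `κ < ½ + 1/202`), here POSITED up to
length `P^Θ`. In print such input exists only BELOW the wall: in the parametrised currency this is the
theorem `Repair.inPrintOffDiagonalRange_iff_belowP` / `Repair.not_inPrintControlled_of_one_le` (p459189:
small moduli, large sieve (7.15), DFI97, BC18 reach no modulus block at or beyond `P`). Relation to B-len's
pricing vocabulary (`KnifeEdgeOffDiagForm`, p458017): under `DiagonalOnlyUpTo` the design's cross
coefficient and overhang constant ARE the `X = 0` atoms `c₀ = tailCoupling`, `k₀ = Re 𝔅_θ(v)`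
(`crossCoeff_of_diagonalOnlyUpTo`, `overhangConst_of_diagonalOnlyUpTo`), so its robust margin is the
`X = 0` one; `0` itself is diagonal-only for every `Θ` (`diagonalOnlyUpTo_zero`, cf. `offDiagForm_zero`).

## Theorems (all elementary over p442741 / p456612)

* `closesByPositivity_of_diagonalOnlyUpTo : 1 < θ → θ ≤ Θ → DiagonalOnlyUpTo Θ X → ClosesByPositivity θ X`
  — a diagonal-only range past `P` is NOT a neutral range extension but an E*-len-STRENGTH hypothesis: it
  decides the sign negatively by itself (the `X = 0` witness `s·g⋆ ⊕ φ_θ` of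
  `RepairRplusTightness.inRplus_twoPiece_closes_without_slot`, value `−1`);
* `not_invisibleOverhang_of_diagonalOnlyUpTo`, `not_diagonalOnlyUpTo_of_invisible` — the two in-print input
  TYPES («diagonal only» vs «invisible tail», `KnifeEdge.InvisibleOverhang`, inhabited by
  `KnifeEdge.invisibleForm θ`) exclude each other past `P`;
* **`diagonalOnlyUpTo_le_one_of_null`** — in any world where the completed two-piece form is positive past
  `P` (`KnifeEdge.Null θ X` for `1 < θ ≤ Θ`: LEVERS §0.6 (B1), the (A)-world expectation) a diagonal-only
  range satisfies `Θ ≤ 1`: THE LARGE-SIEVE-TYPE RANGE CANNOT CROSS THE WALL; equivalently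
  `not_null_of_diagonalOnlyUpTo`.

CURRENCY (C3(e) of barrier/REF-E.md): continued two-piece calculus `twoPieceMainTerm θ X` with an abstract
slot; whether any `X` IS the (A)-world off-diagonal main term is registry E-002 (open); validity of the
continued calculus off `R` is E-017 (open). Numerical certificates: none.

## References

* Y. Zhang, arXiv:2211.02515v1 (2022), §7 Prop. 7.1, (7.2) p.44; §8 (8.11)–(8.12).
  [cite: Zhang2022LandauSiegel, §7 Prop 7.1 (7.2); §8 (8.11)–(8.12)]
-/

noncomputable section

open Real Complex ComplexConjugate Set

namespace Literature.NumberTheory.LFunctions.Zhang2022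

namespace Repair

open KnifeEdge

variable {θ Θ : ℝ} {X : PairFunctional}

/-! ### The predicate -/

/-- **«Large-sieve-TYPE» (diagonal-only) off-diagonal input up to length `P^Θ`** (bare `Prop`, kind (c)): on
every smooth two-piece design of top `θ ∈ [1, Θ]` both `X`-slots vanish — main term = continued diagonal
calculus, off-diagonal = error. In print only for `Θ < 1` (`Repair.inPrintOffDiagonalRange_iff_belowP`).
[cite: Zhang2022LandauSiegel, §7 Prop 7.1 (7.2) p.44] -/
def DiagonalOnlyUpTo (Θ : ℝ) (X : PairFunctional) : Prop :=
  ∀ θ : ℝ, 1 ≤ θ → θ ≤ Θ → ∀ u u' v v' : ℝ → ℂ, InClassPiece u u' → OverhangPiece θ v v' →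
    X u u' v v' = 0 ∧ X v v' v v' = 0

/-- The continued calculus `X = 0` is diagonal-only up to every length. [cite: Zhang2022LandauSiegel, §7 (7.2) p.44] -/
theorem diagonalOnlyUpTo_zero (Θ : ℝ) : DiagonalOnlyUpTo Θ 0 := fun _ _ _ _ _ _ _ _ _ => ⟨rfl, rfl⟩

/-- Monotone in the range: diagonal-only up to `Θ` implies diagonal-only up to every `Θ′ ≤ Θ`.
[cite: Zhang2022LandauSiegel, §7 (7.2) p.44] -/
theorem DiagonalOnlyUpTo.mono {Θ Θ' : ℝ} (h : DiagonalOnlyUpTo Θ X) (hle : Θ' ≤ Θ) : DiagonalOnlyUpTo Θ' X :=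
  fun θ h1 h2 => h θ h1 (h2.trans hle)

/-- With both slots zero the two-piece constant is the continued-calculus (`X = 0`) constant.
[cite: Zhang2022LandauSiegel, §7 Prop 7.1 (7.2) p.44] -/
theorem twoPieceMainTerm_of_slots_zero {u u' v v' : ℝ → ℂ} (h1 : X u u' v v' = 0) (h2 : X v v' v v' = 0)
    (s : ℂ) : twoPieceMainTerm θ X u u' v v' s = twoPieceMainTerm θ 0 u u' v v' s := by
  simp only [twoPieceMainTerm, h1, h2, Pi.zero_apply]

/-- Under a diagonal-only range the B-len pricing atoms of p458017 are the `X = 0` ones: cross coefficient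
`c = c₀ = tailCoupling θ u v`. [cite: Zhang2022LandauSiegel, §7 (7.2) p.44; §8 (8.11)–(8.12)] -/
theorem crossCoeff_of_diagonalOnlyUpTo (hX : DiagonalOnlyUpTo Θ X) (h1 : 1 ≤ θ) (h2 : θ ≤ Θ)
    {u u' v v' : ℝ → ℂ} (hu : InClassPiece u u') (hv : OverhangPiece θ v v') :
    crossCoeff θ X u u' v v' = tailCoupling θ u v := by
  rw [crossCoeff, (hX θ h1 h2 u u' v v' hu hv).1, add_zero]

/-- … and overhang constant `k = k₀ = Re 𝔅_θ(v)`. [cite: Zhang2022LandauSiegel, §7 (7.2) p.44] -/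
theorem overhangConst_of_diagonalOnlyUpTo (hX : DiagonalOnlyUpTo Θ X) (h1 : 1 ≤ θ) (h2 : θ ≤ Θ)
    {u u' v v' : ℝ → ℂ} (hu : InClassPiece u u') (hv : OverhangPiece θ v v') :
    overhangConst θ X v v' = (topDiagForm θ v v').re := by
  rw [overhangConst, (hX θ h1 h2 u u' v v' hu hv).2, Complex.zero_re, mul_zero, add_zero]

/-! ### A diagonal-only range past `P` closes, is not invisible, and is impossible in a PSD world -/

/-- **Large-sieve-type input past `P` CLOSES**: `DiagonalOnlyUpTo Θ X` with `1 < θ ≤ Θ` gives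
`ClosesByPositivity θ X` — by the `X = 0` witness `s·g⋆ ⊕ φ_θ` (value `−1`,
`RepairRplusTightness.inRplus_twoPiece_closes_without_slot`). So positing such input beyond the wall is positing
an E*-len-strength statement, not a range bookkeeping. [cite: Zhang2022LandauSiegel, §7 Prop 7.1 (7.2) p.44] -/
theorem closesByPositivity_of_diagonalOnlyUpTo (hθ : 1 < θ) (hΘ : θ ≤ Θ) (hX : DiagonalOnlyUpTo Θ X) :
    ClosesByPositivity θ X := by
  obtain ⟨s, hmem, hlt⟩ := inRplus_twoPiece_closes_without_slot hθ
  obtain ⟨h1, h2⟩ := hX θ hθ.le hΘ _ _ _ _ hmem.2.1 hmem.2.2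
  exact ⟨gStar, gStar', phiT θ, phiT' θ, s, hmem.2.1, hmem.2.2,
    by rw [twoPieceMainTerm_of_slots_zero h1 h2]; exact hlt⟩

/-- … hence a diagonal-only range past `P` is NOT an invisible world (`KnifeEdge.not_closes_of_invisible`).
[cite: Zhang2022LandauSiegel, §7 Prop 7.1 (7.2) p.44] -/
theorem not_invisibleOverhang_of_diagonalOnlyUpTo (hθ : 1 < θ) (hΘ : θ ≤ Θ) (hX : DiagonalOnlyUpTo Θ X) :
    ¬ InvisibleOverhang θ X :=
  fun h => not_closes_of_invisible h (closesByPositivity_of_diagonalOnlyUpTo hθ hΘ hX)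

/-- Contraposed: an invisible world (e.g. `KnifeEdge.invisibleForm θ`, `invisibleOverhang_invisibleForm`) is
diagonal-only up to NO `Θ ≥ θ > 1` — the two printed input types exclude each other past the wall.
[cite: Zhang2022LandauSiegel, §7 Prop 7.1 (7.2) p.44] -/
theorem not_diagonalOnlyUpTo_of_invisible (hθ : 1 < θ) (hΘ : θ ≤ Θ) (h : InvisibleOverhang θ X) :
    ¬ DiagonalOnlyUpTo Θ X :=
  fun hX => not_invisibleOverhang_of_diagonalOnlyUpTo hθ hΘ hX h

/-- The concrete instance: the explicit invisible form of p458017 is not diagonal-only past `P`.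
[cite: Zhang2022LandauSiegel, §7 Prop 7.1 (7.2) p.44] -/
theorem not_diagonalOnlyUpTo_invisibleForm (hθ : 1 < θ) (hΘ : θ ≤ Θ) :
    ¬ DiagonalOnlyUpTo Θ (invisibleForm θ) :=
  not_diagonalOnlyUpTo_of_invisible hθ hΘ (invisibleOverhang_invisibleForm hθ.le)

/-- A diagonal-only range past `P` contradicts positivity of the completed two-piece form at the top of the
range (`KnifeEdge.Null`). [cite: Zhang2022LandauSiegel, §7 Prop 7.1 (7.2) p.44] -/
theorem not_null_of_diagonalOnlyUpTo (hθ : 1 < θ) (hΘ : θ ≤ Θ) (hX : DiagonalOnlyUpTo Θ X) : ¬ Null θ X := by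
  intro hN
  obtain ⟨u, u', v, v', s, hu, hv, hlt⟩ := closesByPositivity_of_diagonalOnlyUpTo hθ hΘ hX
  exact not_lt.2 (hN u u' v v' s hu hv) hlt

/-- **THE LARGE-SIEVE-TYPE RANGE CANNOT CROSS THE WALL in a PSD world**: if the completed two-piece form is
positive for every top `θ ∈ (1, Θ]` (LEVERS §0.6 (B1): the (A)-world expectation) and `X` is diagonal-only up
to `Θ`, then `Θ ≤ 1`. Companion of `Repair.inPrintOffDiagonalRange_iff_belowP` (the printed range IS the wall).
[cite: Zhang2022LandauSiegel, §7 Prop 7.1 (7.2) p.44] -/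
theorem diagonalOnlyUpTo_le_one_of_null (hX : DiagonalOnlyUpTo Θ X)
    (hN : ∀ θ : ℝ, 1 < θ → θ ≤ Θ → Null θ X) : Θ ≤ 1 := by
  by_contra h
  have hΘ : 1 < Θ := lt_of_not_ge h
  exact not_null_of_diagonalOnlyUpTo hΘ le_rfl hX (hN Θ hΘ le_rfl)

end Repair

end Literature.NumberTheory.LFunctions.Zhang2022
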